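import Mathlib.Analysis.Asymptotics.Lemmas
import Literature.Computability.Complexity.CircuitLowerBounds
import Literature.Computability.Complexity.CircuitSizeProofs
import HarnessLib

/-!
# Li–Yang's `3.1 n - o(n)` lower bound: the explicit form and the reduction of `li_yang` to it

`Literature.Computability.Complexity.li_yang` (pnp.S23, `CircuitLowerBounds.lean`) is Theorem 1.1 of Li–Yang (STOC 2022):
every `B₂`-circuit computing an affine disperser for sublinear dimension has at least
`3.1 n - o(n)` gates. The printed proof (STOC 2022 §3–§4; full version ECCC TR21-023, §3–§4)
establishes an **explicit** inequality, from which Theorem 1.1 is read off: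

* (Def. 3.6) the complexity measure `μ(C, 𝒫, R) = g + α_I · i + α_Q · q + α_φ · Φ(C, 𝒫)` of a
  circuit `C` with `g` gates, `i` influential inputs, `q` quadratic equations in the rdq-source
  `R`, and potential `Φ(C, 𝒫)` (number of troubled gates minus the size of the packing `𝒫`);
* (Lemma 3.7 = Find–Golovnev–Hirsch–Kulikov 2016, Lemma 3; Cor. 3.8) a circuit computing an
  affine disperser for dimension `d` has at most `n/2 + 5d/2` troubled gates, so
  `Φ(C, 𝒫) ≤ n/2 + 5d/2`;
* (Thm. 3.9) hence, if computing `f` requires `μ(C, 𝒫, ∅) ≥ μ₀` for every circuit `C` and packing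
  `𝒫`, then `|C| ≥ μ₀ - α_I · n - α_φ · (n/2 + 5d/2)` (as `i ≤ n` and `q = 0` for `R = ∅`);
* (Thm. 4.1, the gate-elimination case analysis) for every circuit `C` computing an affine
  disperser for dimension `d` and every packing `𝒫`, `μ(C, 𝒫, ∅) ≥ δ (n - 2d - 2)` with
  `δ = α_I + min {α_I/3, 2 - 2α_φ + α_Q, 4 - 4α_φ, 3 + α_φ, 5 - α_Q, (5 - 2α_φ + α_Q)/2}`;
* (proof of Thm. 1.1) the optimal parameters `α_φ = 0.2`, `α_I = 9.6`, `α_Q = 1.8` give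
  `δ = 12.8` and `δ - α_φ/2 - α_I = 3.1`.

Combining Thm. 3.9 (first sentence) with Thm. 4.1 at these parameters gives, for **every** `n`, `d`,
every affine disperser `f : 𝔽₂ⁿ → {0,1}` for dimension `d` and every `B₂`-circuit `C` computing
`f`: `|C| ≥ 12.8 (n - 2d - 2) - 9.6 n - 0.2 (n/2 + 5d/2) = 3.1 n - 26.1 d - 25.6`.
We vendor this explicit inequality as the named fact `LiYang2022_size_ge` (its discharge is the
whole gate-elimination proof, a theory of its own: fair semicircuits, rdq-sources, troubled
gates, normalization, and the case analysis of ECCC TR21-023 §4.1), and PROVE here that it implies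
`li_yang`: with `e n = 26.1 · d n + 25.6`, `d = o(n)` gives `e = o(n)`, and the infimum
`circuitSizeOver B2 (f ∘ boolOfZMod2)` is attained because every Boolean function on `Fin n` has a
`B₂`-circuit (`cktSize_univ`, `exists_circuit_size_eq_circuitSizeOver`).

## Model remarks

Li–Yang's circuits (§2.1) are DAGs whose gates have fan-in exactly `2` and carry any of the 16
binary Boolean functions (trivial and degenerate gates allowed; size = number of gates; inputs
and constants are not counted). H21's `B2 = {f | f.1 ≤ 2}` also admits gates of arity `0` and `1`,
which `Circuit.size` counts; for `n ≥ 1` such a gate is a trivial/degenerate binary gate with a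
dummy second wire, so an H21 `B2`-circuit of size `s` is a Li–Yang circuit of size `s` computing
the same function, and the printed bound transfers verbatim. Gate-free H21 circuits (output wire
an input) compute projections, which are affine dispersers only for `d ≥ n`, where the bound is
negative; likewise `n = 0`. `IsAffineDisperser f d` (non-constant on every nonempty affine
subspace of dimension `≥ d`) is equivalent to the paper's Def. in §2.2 (non-constant under every
partition into `d` free and `n - d` affine variables, i.e. on every affine subspace of dimension
exactly `d`).

## References

* J. Li, T. Yang, *3.1n − o(n) circuit lower bounds for explicit functions*, STOC 2022,
  1180–1193, Thm. 1.1, Def. 3.6, Lemma 3.7, Cor. 3.8, Thm. 3.9, Thm. 4.1 and the proof of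
  Thm. 1.1 in §4 [LiYang2022]; full version ECCC TR21-023 (2021), pp. 14–19.
* M. G. Find, A. Golovnev, E. A. Hirsch, A. S. Kulikov, *A better-than-3n lower bound for the
  circuit complexity of an explicit function*, FOCS 2016, Lemma 3 (the troubled-gate count).
-/

namespace Literature.Computability.Complexity

open Filter Asymptotics

/-- (Li–Yang, STOC 2022: Thm. 3.9 combined with Thm. 4.1 at the parameters
`(α_φ, α_I, α_Q, δ) = (0.2, 9.6, 1.8, 12.8)` of the proof of Thm. 1.1, §4.) For every `n`, `d`,
every affine disperser `f : 𝔽₂ⁿ → {0,1}` for dimension `d` and every circuit `C` over the full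
binary basis `B₂` computing `f` (as a Boolean function, via `boolOfZMod2`),
`|C| ≥ μ₀ - α_I · n - α_φ · (n/2 + 5d/2)` with `μ₀ = δ (n - 2d - 2)`, i.e.
`12.8 (n - 2d - 2) - 9.6 n - 0.2 (n/2 + 5d/2) ≤ C.size` (`= 3.1 n - 26.1 d - 25.6`,
`LiYang2022_size_ge.size_ge`). This is the explicit inequality behind the printed
`3.1 n - o(n)` (Thm. 1.1 = `li_yang`, derived in `LiYang2022_size_ge.li_yang`); its proof is the
gate-elimination case analysis of §4.1 of the full version (ECCC TR21-023) together with
Lemma 3.7 (= Find–Golovnev–Hirsch–Kulikov 2016, Lemma 3).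
[cite: LiYang2022, Thm. 3.9, Thm. 4.1 and proof of Thm. 1.1 (§4)] -/
def LiYang2022_size_ge : Prop :=
  ∀ (n d : ℕ) (f : (Fin n → ZMod 2) → Bool), IsAffineDisperser f d →
    ∀ C : Circuit (Fin n), C.IsOver B2 → C.Computes (f ∘ boolOfZMod2) →
      (12.8 : ℝ) * ((n : ℝ) - 2 * d - 2) - 9.6 * n - 0.2 * ((n : ℝ) / 2 + 5 * (d : ℝ) / 2) ≤
        (C.size : ℝ)

/-- The explicit Li–Yang bound with the constants collected: every `B₂`-circuit computing an
affine disperser for dimension `d` on `n` variables has at least `3.1 n - 26.1 d - 25.6` gates.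
[cite: LiYang2022, Thm. 3.9 and Thm. 4.1] -/
theorem LiYang2022_size_ge.size_ge (h : LiYang2022_size_ge) {n d : ℕ}
    {f : (Fin n → ZMod 2) → Bool} (hf : IsAffineDisperser f d) (C : Circuit (Fin n))
    (hB : C.IsOver B2) (hC : C.Computes (f ∘ boolOfZMod2)) :
    (3.1 : ℝ) * n - 26.1 * d - 25.6 ≤ (C.size : ℝ) := by
  have := h n d f hf C hB hC
  linarith

/-- Every Boolean function on `Fin n → Bool` is computed by some circuit over `B₂`
(Shannon expansion, `cktSize_univ`; Arora–Barak 2009, Claim 2.13), so the infimum defining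
`circuitSizeOver B2 g` is attained. [cite: AroraBarakCC2009, Claim 2.13] -/
theorem exists_B2_computes (n : ℕ) (g : (Fin n → Bool) → Bool) :
    ∃ C : Circuit (Fin n), C.IsOver B2 ∧ C.Computes g ∧ C.size = circuitSizeOver B2 g := by
  obtain ⟨C, hB, -, hC⟩ := (cktSize_univ fun (x : Fin n → Bool) (_ : Unit) => g x).toCircuit
  exact exists_circuit_size_eq_circuitSizeOver ⟨C, hB, fun x => hC x⟩

/-- The explicit Li–Yang bound for the circuit complexity `circuitSizeOver B2`: for every affine
disperser `f` for dimension `d` on `n` variables,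
`3.1 n - 26.1 d - 25.6 ≤ circuitSizeOver B2 (f ∘ boolOfZMod2)` (the infimum is attained by
`exists_B2_computes`). [cite: LiYang2022, Thm. 3.9 and Thm. 4.1] -/
theorem LiYang2022_size_ge.circuitSizeOver_ge (h : LiYang2022_size_ge) {n d : ℕ}
    {f : (Fin n → ZMod 2) → Bool} (hf : IsAffineDisperser f d) :
    (3.1 : ℝ) * n - 26.1 * d - 25.6 ≤ (circuitSizeOver B2 (f ∘ boolOfZMod2) : ℝ) := by
  obtain ⟨C, hB, hC, hsize⟩ := exists_B2_computes n (f ∘ boolOfZMod2)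
  rw [← hsize]
  exact h.size_ge hf C hB hC

/-- A real constant is `o(n)` along `atTop` on `ℕ`. [folklore] -/
theorem isLittleO_const_natCast (c : ℝ) :
    (fun _ : ℕ => c) =o[atTop] fun n : ℕ => (n : ℝ) := by
  refine isLittleO_const_left.2 (Or.inr ?_)
  have : (norm ∘ fun n : ℕ => (n : ℝ)) = fun n : ℕ => (n : ℝ) := by
    funext n
    simp
  rw [this]
  exact tendsto_natCast_atTop_atTop

/-- **Li–Yang's Theorem 1.1 from the explicit bound.** `LiYang2022_size_ge` implies
`li_yang` (pnp.S23): given a dimension bound `d = o(n)`, the error term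
`e n = 26.1 · d n + 25.6` is `o(n)`, and for every `n` and every affine disperser `f` for
dimension `d n`, `3.1 n - e n ≤ circuitSizeOver B2 (f ∘ boolOfZMod2)`
(Li–Yang 2022, proof of Thm. 1.1 from Thm. 3.9 and Thm. 4.1). [cite: LiYang2022, Thm. 1.1] -/
theorem LiYang2022_size_ge.li_yang (h : LiYang2022_size_ge) : li_yang := by
  intro d hd
  refine ⟨fun n => 26.1 * (d n : ℝ) + 25.6, ?_, fun n f hf => ?_⟩
  · exact (hd.const_mul_left 26.1).add (isLittleO_const_natCast 25.6)
  · have := h.circuitSizeOver_ge hf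
    linarith

end Literature.Computability.Complexity
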